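import Mathlib
import Summits.Ventures.PercRepro2.Defs
import Summits.Ventures.PercRepro2.Independence
import Summits.Ventures.PercRepro2.Harris
import Summits.Ventures.PercRepro2.Graph
import Summits.Ventures.PercRepro2.Exploration
import Summits.Ventures.PercRepro2.Events
import Summits.Ventures.PercRepro2.Induced
import Summits.Ventures.PercRepro2.BoxUnionDefs
import Summits.Ventures.PercRepro2.BoxUnion
import Summits.Ventures.PercRepro2.BoxUnionPair
import Summits.Ventures.PercRepro2.PairTP2
import Summits.Ventures.PercRepro2.PairTP2Main
import Summits.Ventures.PercRepro2.SeparatedDefs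
import Summits.Ventures.PercRepro2.SeparatedPair

/-!
# (PAIR-TP2), the (⟹) direction — part 1: closure lemmas
(blind cell PercRepro2, mine-1 g39; proofs/MINE1-PAIRTP2.md §2′ without walks)

General facts about connections in a finite bond configuration, all by the closure lemma
`mem_of_conn_of_closed`: a vertex without open edges is isolated; the BRIDGE lemma (closing an
edge `{a, b}` either keeps `x ↔ y` or splits it at the edge); the LEAF lemma (the only open edge
at `z` can be closed without disconnecting vertices other than `z`); closing an edge that does not
touch a cluster leaves it unchanged; an open edge at `s` does not touch the cluster of `t` when
`s ↮ t`. Plus the open-edge count used by the minimality arguments of `PairTP2BroomExists`.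
-/

namespace Summit.Ventures.PercRepro2

namespace PairTP2Broom

open Finset
open scoped Classical

variable {V : Type*} {E : Type*} {ends : E → Sym2 V}

/-! ### Closure lemmas: isolation, bridges, leaves -/

/-- A vertex with no open edge at it is connected to nothing else. -/
lemma eq_of_conn_of_isolated {ω : Config E} {z : V} (h : ∀ e, ω e = true → z ∉ ends e)
    {x : V} (hc : Conn ends ω z x) : x = z := by
  have hx : x ∈ ({z} : Set V) := by
    refine mem_of_conn_of_closed (S := ({z} : Set V)) ?_ (Set.mem_singleton z) hc
    intro a ha b hab
    rw [Set.mem_singleton_iff] at ha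
    subst ha
    obtain ⟨-, e, he, hends⟩ := openGraph_adj.1 hab
    exact absurd (by rw [hends]; exact Sym2.mem_mk_left a b) (h e he)
  exact hx

/-- A vertex connected to another one has an open edge at it. -/
lemma exists_open_edge_at {ω : Config E} {x y : V} (hxy : x ≠ y) (h : Conn ends ω x y) :
    ∃ e, ω e = true ∧ x ∈ ends e := by
  by_contra hno
  exact hxy (eq_of_conn_of_isolated (fun e he hz => hno ⟨e, he, hz⟩) h).symm

section Update

variable [DecidableEq E]

/-- **Bridge lemma**: closing an edge `e = {a, b}` either keeps `x ↔ y`, or `x` reaches one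
endpoint and the other endpoint reaches `y` without `e`. -/
lemma conn_update_false_cases {ω : Config E} {e : E} {a b : V} (hends : ends e = s(a, b))
    {x y : V} (h : Conn ends ω x y) :
    Conn ends (Function.update ω e false) x y ∨
      (Conn ends (Function.update ω e false) x a ∧ Conn ends (Function.update ω e false) b y) ∨
      (Conn ends (Function.update ω e false) x b ∧ Conn ends (Function.update ω e false) a y) := by
  set ω' := Function.update ω e false with hω'
  by_cases hxy : Conn ends ω' x y
  · exact Or.inl hxy
  right
  -- the cluster of `x` in `ω'` is not closed under `ω`-adjacency
  obtain ⟨p, hp, q, hpq, hq⟩ : ∃ p ∈ cluster ends ω' x, ∃ q, (openGraph ends ω).Adj p q ∧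
      q ∉ cluster ends ω' x := by
    by_contra hno
    apply hxy
    refine mem_of_conn_of_closed (ends := ends) (ω := ω) (S := cluster ends ω' x)
      (fun p hp q hpq => ?_) (mem_cluster_self ends ω' x) h
    by_contra hq
    exact hno ⟨p, hp, q, hpq, hq⟩
  obtain ⟨-, e', he', hends'⟩ := openGraph_adj.1 hpq
  have hee : e' = e := by
    by_contra hne'
    have h1 : ω' e' = true := by rw [hω', Function.update_of_ne hne']; exact he'
    exact hq (mem_cluster_of_adj hp (openGraph_adj.2 ⟨(openGraph_adj.1 hpq).1, e', h1, hends'⟩))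
  rw [hee] at hends'
  -- the general step: an open edge `{c, d}` of `ω` leaving the cluster of `x`
  have key : ∀ c d : V, ends e = s(c, d) → c ∈ cluster ends ω' x → d ∉ cluster ends ω' x →
      Conn ends ω' x c ∧ Conn ends ω' d y := by
    intro c d hcd hc hd
    refine ⟨hc, ?_⟩
    have hy : y ∈ cluster ends ω' x ∪ cluster ends ω' d := by
      refine mem_of_conn_of_closed (S := cluster ends ω' x ∪ cluster ends ω' d) ?_
        (Or.inl (mem_cluster_self ends ω' x)) h
      intro z hz w hzw
      obtain ⟨hzw', f, hf, hfends⟩ := openGraph_adj.1 hzw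
      by_cases hfe : f = e
      · rw [hfe, hcd, Sym2.eq_iff] at hfends
        rcases hfends with ⟨-, hdw⟩ | ⟨hcw, -⟩
        · rw [← hdw]
          exact Or.inr (mem_cluster_self ends ω' d)
        · rw [← hcw]
          exact Or.inl hc
      · have hf' : ω' f = true := by rw [hω', Function.update_of_ne hfe]; exact hf
        have hadj : (openGraph ends ω').Adj z w := openGraph_adj.2 ⟨hzw', f, hf', hfends⟩
        rcases hz with hz | hz
        · exact Or.inl (mem_cluster_of_adj hz hadj)
        · exact Or.inr (mem_cluster_of_adj hz hadj)
    rcases hy with hy | hy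
    · exact absurd hy hxy
    · exact hy
  have hpq' := hends'
  rw [hends, Sym2.eq_iff] at hpq'
  rcases hpq' with ⟨hap, hbq⟩ | ⟨haq, hbp⟩
  · have := key p q hends' hp hq
    rw [← hap, ← hbq] at this
    exact Or.inl this
  · have := key p q hends' hp hq
    rw [← haq, ← hbp] at this
    exact Or.inr this

/-- **Leaf lemma**: if `e` is the only open edge at `z`, closing it does not disconnect two
vertices other than `z`. -/
lemma conn_update_false_of_leaf {ω : Config E} {e : E} {z w : V} (hends : ends e = s(z, w))
    (huniq : ∀ f, ω f = true → z ∈ ends f → f = e) {x y : V} (hx : x ≠ z) (hy : y ≠ z)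
    (h : Conn ends ω x y) : Conn ends (Function.update ω e false) x y := by
  have hiso : ∀ f, Function.update ω e false f = true → z ∉ ends f := by
    intro f hf hz
    by_cases hfe : f = e
    · rw [hfe, Function.update_self] at hf
      exact Bool.false_ne_true hf
    · rw [Function.update_of_ne hfe] at hf
      exact hfe (huniq f hf hz)
  rcases conn_update_false_cases hends h with h1 | ⟨h1, -⟩ | ⟨-, h1⟩
  · exact h1
  · exact absurd (eq_of_conn_of_isolated hiso (conn_symm h1)) hx
  · exact absurd (eq_of_conn_of_isolated hiso h1) hy

/-- Closing an edge that does not touch the cluster of `v` leaves that cluster unchanged. -/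
lemma cluster_update_false_of_not_touches {ω : Config E} {e : E} {v : V}
    (h : e ∉ touches ends (cluster ends ω v)) :
    cluster ends (Function.update ω e false) v = cluster ends ω v :=
  cluster_eq_of_eqOn_touches (fun f hf => by
    by_cases hfe : f = e
    · exact absurd (hfe ▸ hf) h
    · rw [Function.update_of_ne hfe]) rfl

end Update

/-- An open edge at `s` does not touch the cluster of `t` when `t ↮ s`. -/
lemma not_touches_cluster_of_open_at {ω : Config E} {s t : V} (hst : ¬ Conn ends ω t s)
    {e : E} (he : ω e = true) (hs : s ∈ ends e) : e ∉ touches ends (cluster ends ω t) := by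
  rintro ⟨y, hy, z, hyz⟩
  rw [hyz, Sym2.mem_iff] at hs
  rcases hs with hsy | hsz
  · apply hst
    rw [hsy]
    exact hy
  · by_cases hyz' : y = z
    · apply hst
      rw [hsz, ← hyz']
      exact hy
    · apply hst
      rw [hsz]
      exact mem_cluster_of_adj hy (openGraph_adj.2 ⟨hyz', e, he, hyz⟩)

/-- `ω ≤ ω'` from the implication on open edges. -/
lemma config_le_of_imp {ω ω' : Config E} (h : ∀ e, ω e = true → ω' e = true) : ω ≤ ω' := by
  intro e
  cases hω : ω e
  · exact Bool.false_le _
  · simp [h e hω]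

/-- The code is `1` iff the vertex lies in neither cluster. -/
lemma code_eq_one_iff' [Fintype V] [DecidableEq V] [Fintype E] (s t : V) (ω : Config E) (x : V) :
    PairTP2.code ends s t ω x = 1 ↔ ¬ Conn ends ω s x ∧ ¬ Conn ends ω t x := by
  unfold PairTP2.code
  split_ifs <;> simp [*]

section Update

variable [DecidableEq E]

/-- Closing an edge only closes. -/
lemma update_false_imp (ω : Config E) (f : E) :
    ∀ e, Function.update ω f false e = true → ω e = true := by
  intro e he
  by_cases hef : e = f
  · rw [hef, Function.update_self] at he
    exact absurd he Bool.false_ne_true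
  · rw [Function.update_of_ne hef] at he
    exact he

end Update

section Count

variable [Fintype E]

/-- The number of open edges. -/
def openCount (ω : Config E) : ℕ := (Finset.univ.filter (fun e => ω e = true)).card

/-- Closing an open edge (and possibly more) strictly lowers the count. -/
lemma openCount_lt_of_le {ω ω' : Config E} (h : ∀ e, ω' e = true → ω e = true) {e : E}
    (he : ω e = true) (he' : ω' e = false) : openCount ω' < openCount ω := by
  apply Finset.card_lt_card
  rw [Finset.ssubset_iff_of_subset]
  · exact ⟨e, by simp [he], by simp [he']⟩
  · intro f hf
    simp only [Finset.mem_filter, Finset.mem_univ, true_and] at hf ⊢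
    exact h f hf

end Count

end PairTP2Broom

end Summit.Ventures.PercRepro2
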